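import Literature.Computability.Complexity.ExpanderOps
import HarnessLib

/-!
# Complete graphs as rotation maps: uniform degree on every vertex count, edge expansion, spectral bound

Topic `Computability/Complexity`, namespace `Literature.Computability.Complexity.Expander.RotGraph`.
The "trivial expanders" used by the tree's ONE-SHOT reduction from gap-E3SAT to gap label cover
(`GapE3CNFToLabelCover.lean`, to come), in place of the constant-degree expander families that Dinur's iterated
rounds need (`ExpanderFamily.lean`): a single application of degree reduction / expanderization may use
graphs of polynomial degree, and complete graphs have the best possible expansion and the simplest
possible rotation maps (plain modular arithmetic — which is what makes the polynomial-time machine of the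
reduction elementary).

* `cc k K : RotGraph k K` — **the complete graph on `Fin k` with uniform degree `K`** for ANY `K`: label
  `i = a k + b < ⌊K/k⌋ k` is the `a`-th parallel copy of the dart `v → v + b (mod k)` (reverse label
  `a k + (k - b) mod k`), the remaining `K mod k` labels are self-loops.  So one degree `K` serves every
  vertex count `k ≤ K` (as the cloud expanders `X k` of degree reduction, Arora–Barak Claim 22.37, must).
* `cc_edgeExpansion` — for `1 ≤ k ≤ K` every `Q` with `2|Q| ≤ k` has at least `(K/4) |Q|` darts leaving it
  (`|Q| ⌊K/k⌋ (k - |Q|)` exactly leave through the complete part, and `⌊K/k⌋ k > K/2`).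
* `spectralBound_cc_self` — `cc N N` (every ordered pair exactly once, i.e. `K_N` with a loop at each
  vertex) has walk matrix `J/N` and hence spectral bound `0`.

## References

* S. Arora, B. Barak, *Computational Complexity: A Modern Approach*, CUP 2009, §21.1 (walk matrices,
  `λ(G)`), §22.2.3 eq. (22.1) (edge expansion), §22.A Claims 22.37–22.38 (where expanders enter).
-/

namespace Literature.Computability.Complexity

open Finset Matrix

namespace Expander

namespace RotGraph

/-! ### Modular arithmetic of the reverse label -/

/-- `b + (k - b) mod k ≡ 0 (mod k)` for `b < k`. [folklore] -/
theorem add_sub_mod_mod {k b : ℕ} (hb : b < k) : (b + (k - b) % k) % k = 0 := by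
  rcases Nat.eq_zero_or_pos b with rfl | hb0
  · simp
  · rw [Nat.mod_eq_of_lt (by omega : k - b < k), Nat.add_sub_cancel' hb.le, Nat.mod_self]

/-- `(k - (k - b) mod k) mod k = b` for `b < k`. [folklore] -/
theorem sub_sub_mod_mod {k b : ℕ} (hb : b < k) : (k - (k - b) % k) % k = b := by
  rcases Nat.eq_zero_or_pos b with rfl | hb0
  · simp
  · rw [Nat.mod_eq_of_lt (by omega : k - b < k), Nat.sub_sub_self hb.le, Nat.mod_eq_of_lt hb]

/-- A label below `⌊K/k⌋ k` split as `a k + b` recombines below `⌊K/k⌋ k ≤ K` with any `b' < k`. [folklore] -/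
theorem div_mul_add_lt {k K i b' : ℕ} (hi : i < K / k * k) (hb' : b' < k) : i / k * k + b' < K := by
  have hk : 0 < k := Nat.pos_of_ne_zero fun h => by subst h; simp at hi
  have ha : i / k < K / k := (Nat.div_lt_iff_lt_mul hk).2 hi
  calc i / k * k + b' < i / k * k + k := Nat.add_lt_add_left hb' _
    _ = (i / k + 1) * k := by ring
    _ ≤ K / k * k := Nat.mul_le_mul_right _ ha
    _ ≤ K := Nat.div_mul_le_self K k

/-! ### The complete graph with uniform degree -/

/-- The rotation map of `cc k K`. [folklore] -/
def ccRot (k K : ℕ) (x : Fin k × Fin K) : Fin k × Fin K :=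
  if h : x.2.val < K / k * k then
    (⟨(x.1.val + x.2.val % k) % k, Nat.mod_lt _ x.1.pos⟩,
     ⟨x.2.val / k * k + (k - x.2.val % k) % k, div_mul_add_lt h (Nat.mod_lt _ x.1.pos)⟩)
  else x

/-- `ccRot` is an involution. [folklore] -/
theorem ccRot_ccRot (k K : ℕ) (x : Fin k × Fin K) : ccRot k K (ccRot k K x) = x := by
  obtain ⟨v, i⟩ := x
  have hk : 0 < k := v.pos
  unfold ccRot
  by_cases h : i.val < K / k * k
  · rw [dif_pos h]
    simp only
    have hb : i.val % k < k := Nat.mod_lt _ hk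
    have hb' : (k - i.val % k) % k < k := Nat.mod_lt _ hk
    -- the new label is in the same block
    have hdiv : (i.val / k * k + (k - i.val % k) % k) / k = i.val / k := by
      rw [Nat.add_comm, Nat.add_mul_div_right _ _ hk, Nat.div_eq_of_lt hb', Nat.zero_add]
    have hmod : (i.val / k * k + (k - i.val % k) % k) % k = (k - i.val % k) % k := by
      rw [Nat.add_comm, Nat.add_mul_mod_self_right, Nat.mod_eq_of_lt hb']
    have hlt : i.val / k * k + (k - i.val % k) % k < K / k * k := by
      have ha : i.val / k < K / k := (Nat.div_lt_iff_lt_mul hk).2 h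
      calc i.val / k * k + (k - i.val % k) % k < i.val / k * k + k := Nat.add_lt_add_left hb' _
        _ = (i.val / k + 1) * k := by ring
        _ ≤ K / k * k := Nat.mul_le_mul_right _ ha
    rw [dif_pos hlt]
    refine Prod.ext (Fin.ext ?_) (Fin.ext ?_)
    · simp only [hmod]
      rw [Nat.add_mod, Nat.mod_mod, ← Nat.add_mod, Nat.add_assoc, Nat.add_mod, add_sub_mod_mod hb, Nat.add_zero, Nat.mod_mod,
        Nat.mod_eq_of_lt v.isLt]
    · simp only [hdiv, hmod]
      rw [sub_sub_mod_mod hb, Nat.div_add_mod']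
  · rw [dif_neg h, dif_neg h]

/-- **The complete graph on `k` vertices with uniform degree `K`** (parallel copies of every ordered pair,
padded with self-loops). [cite: AroraBarakCC2009, §21.1 (regular multigraphs with self-loops and parallel edges)] -/
def cc (k K : ℕ) : RotGraph k K := ⟨ccRot k K, ccRot_ccRot k K⟩

/-- The neighbour along a label of the complete part. [folklore] -/
theorem cc_nbr_of_lt {k K : ℕ} (v : Fin k) (i : Fin K) (h : i.val < K / k * k) :
    ((cc k K).nbr v i).val = (v.val + i.val % k) % k := by
  show (ccRot k K (v, i)).1.val = _
  unfold ccRot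
  rw [dif_pos h]

/-- The remaining labels are self-loops. [folklore] -/
theorem cc_nbr_of_le {k K : ℕ} (v : Fin k) (i : Fin K) (h : K / k * k ≤ i.val) : (cc k K).nbr v i = v := by
  show (ccRot k K (v, i)).1 = v
  unfold ccRot
  rw [dif_neg (Nat.not_lt.2 h)]

/-! ### Edge expansion -/

/-- `⌊K/k⌋ k > K/2` for `1 ≤ k ≤ K` (the complete part carries more than half of the labels). [folklore] -/
theorem lt_two_mul_div_mul {k K : ℕ} (hk : 0 < k) (hkK : k ≤ K) : K < 2 * (K / k * k) := by
  have h1 : 1 ≤ K / k := (Nat.le_div_iff_mul_le hk).2 (by simpa using hkK)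
  have h2 : K % k < k := Nat.mod_lt _ hk
  have h3 : K / k * k + K % k = K := Nat.div_add_mod' K k
  nlinarith

/-- **Edge expansion of `cc k K`** (`1 ≤ k ≤ K`): a vertex set `Q` with `2|Q| ≤ k` has at least `(K/4)·|Q|`
darts leaving it — the form of hypothesis `hX` of `DegreeReductionSoundness.degreeReduction_soundness`.
Through the complete part alone, exactly `|Q| · ⌊K/k⌋ · (k - |Q|)` darts leave `Q` (inject
`(v, a, w) ∈ Q × [⌊K/k⌋] × Qᶜ` as the `a`-th copy of `v → w`). [cite: AroraBarakCC2009, §22.2.3 eq. (22.1) (edge expansion)] -/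
theorem cc_edgeExpansion {k K : ℕ} (hk : 0 < k) (hkK : k ≤ K) (Q : Finset (Fin k)) (hQ : 2 * Q.card ≤ k) :
    ((K : ℝ) / 4) * Q.card ≤ ((univ.filter fun x : Fin k × Fin K => x.1 ∈ Q ∧ (cc k K).nbr x.1 x.2 ∉ Q).card : ℝ) := by
  classical
  set t := K / k with ht
  have htk : t * k ≤ K := Nat.div_mul_le_self K k
  -- the injection `(v, a, w) ↦ (v, a k + (w - v) mod k)`
  set lab : Fin k → Fin t → Fin k → ℕ := fun v a w => a.val * k + (w.val + (k - v.val)) % k with hlab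
  have hlab_lt : ∀ v a w, lab v a w < t * k := fun v a w => by
    calc lab v a w < a.val * k + k := Nat.add_lt_add_left (Nat.mod_lt _ hk) _
      _ = (a.val + 1) * k := by ring
      _ ≤ t * k := Nat.mul_le_mul_right _ a.isLt
  set f : Fin k × Fin t × Fin k → Fin k × Fin K := fun p => (p.1, ⟨lab p.1 p.2.1 p.2.2, lt_of_lt_of_le (hlab_lt _ _ _) htk⟩)
    with hf
  have hmodlab : ∀ v a w, lab v a w % k = (w.val + (k - v.val)) % k := fun v a w => by
    rw [hlab]; simp only; rw [Nat.add_comm, Nat.add_mul_mod_self_right, Nat.mod_mod]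
  have hdivlab : ∀ v a w, lab v a w / k = a.val := fun v a w => by
    rw [hlab]; simp only; rw [Nat.add_comm, Nat.add_mul_div_right _ _ hk, Nat.div_eq_of_lt (Nat.mod_lt _ hk), Nat.zero_add]
  have hnbr : ∀ v a w, (cc k K).nbr (f (v, a, w)).1 (f (v, a, w)).2 = w := fun v a w => by
    apply Fin.ext
    rw [hf]
    simp only
    rw [cc_nbr_of_lt _ _ (hlab_lt v a w), hmodlab]
    rw [Nat.add_mod, Nat.mod_mod, ← Nat.add_mod, ← Nat.add_assoc, Nat.add_comm v.val, Nat.add_assoc,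
      Nat.add_sub_cancel' v.isLt.le, Nat.add_mod_right, Nat.mod_eq_of_lt w.isLt]
  have hinj : Set.InjOn f ↑(Q ×ˢ ((univ : Finset (Fin t)) ×ˢ Qᶜ)) := by
    rintro ⟨v, a, w⟩ - ⟨v', a', w'⟩ - h
    have hv : v = v' := congrArg Prod.fst h
    subst hv
    have hw : w = w' := by rw [← hnbr v a w, ← hnbr v a' w', h]
    subst hw
    have ha : a = a' := by
      have := congrArg (fun p : Fin k × Fin K => p.2.val / k) h
      simp only [hf, hdivlab] at this
      exact Fin.ext this
    subst ha
    rfl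
  have hmaps : ∀ p ∈ Q ×ˢ ((univ : Finset (Fin t)) ×ˢ Qᶜ), f p ∈ univ.filter fun x : Fin k × Fin K => x.1 ∈ Q ∧ (cc k K).nbr x.1 x.2 ∉ Q := by
    rintro ⟨v, a, w⟩ hp
    simp only [mem_product, mem_univ, true_and, mem_compl] at hp
    simp only [mem_filter, mem_univ, true_and]
    refine ⟨hp.1, ?_⟩
    rw [hnbr]
    exact hp.2
  have hcard := card_le_card_of_injOn f hmaps hinj
  rw [card_product, card_product, card_univ, Fintype.card_fin, card_compl, Fintype.card_fin] at hcard
  -- arithmetic: `|Q| t (k - |Q|) ≥ (K/4) |Q|`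
  have hQk : Q.card ≤ k := by omega
  have h2 : K < 2 * (t * k) := lt_two_mul_div_mul hk hkK
  have hR : ((Q.card * (t * (k - Q.card)) : ℕ) : ℝ) ≤ ((univ.filter fun x : Fin k × Fin K => x.1 ∈ Q ∧ (cc k K).nbr x.1 x.2 ∉ Q).card : ℝ) := by
    exact_mod_cast hcard
  refine le_trans ?_ hR
  rw [Nat.cast_mul, Nat.cast_mul, Nat.cast_sub hQk]
  have hkQ : (k : ℝ) / 2 ≤ (k : ℝ) - Q.card := by
    have : (2 * Q.card : ℝ) ≤ k := by exact_mod_cast hQ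
    linarith
  have htk2 : (K : ℝ) / 2 ≤ (t : ℝ) * k := by
    have : (K : ℝ) < 2 * ((t * k : ℕ) : ℝ) := by exact_mod_cast h2
    push_cast at this
    linarith
  have hQ0 : (0 : ℝ) ≤ Q.card := Nat.cast_nonneg _
  -- `K/4 ≤ t (k - |Q|)` since `t (k-|Q|) ≥ t k / 2 ≥ K/4`
  have hmain : (K : ℝ) / 4 ≤ (t : ℝ) * ((k : ℝ) - Q.card) := by
    have ht0 : (0 : ℝ) ≤ t := Nat.cast_nonneg _
    have h1 : (t : ℝ) * ((k : ℝ) / 2) ≤ (t : ℝ) * ((k : ℝ) - Q.card) := mul_le_mul_of_nonneg_left hkQ ht0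
    nlinarith
  calc (K : ℝ) / 4 * Q.card ≤ (t : ℝ) * ((k : ℝ) - Q.card) * Q.card := mul_le_mul_of_nonneg_right hmain hQ0
    _ = Q.card * (t * (k - Q.card)) := by ring

/-! ### The complete graph proper and its spectral bound -/

/-- In `cc N N` every label is in the complete part (`⌊N/N⌋ N = N`). [folklore] -/
theorem cc_self_nbr {N : ℕ} (v : Fin N) (i : Fin N) : ((cc N N).nbr v i).val = (v.val + i.val) % N := by
  have hN : 0 < N := v.pos
  have h : i.val < N / N * N := by rw [Nat.div_self hN, one_mul]; exact i.isLt
  rw [cc_nbr_of_lt v i h, Nat.mod_eq_of_lt i.isLt]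

/-- From `u`, exactly one label of `cc N N` leads to `v`. [folklore] -/
theorem card_cc_self_nbr_eq {N : ℕ} (u v : Fin N) : ((univ : Finset (Fin N)).filter fun i => (cc N N).nbr u i = v).card = 1 := by
  have hN : 0 < N := u.pos
  rw [card_eq_one]
  refine ⟨⟨(v.val + (N - u.val)) % N, Nat.mod_lt _ hN⟩, ?_⟩
  ext i
  simp only [mem_filter, mem_univ, true_and, mem_singleton]
  constructor
  · intro h
    apply Fin.ext
    have h' := congrArg Fin.val h
    rw [cc_self_nbr] at h'
    simp only
    -- `i = (v - u) mod N`
    have : (v.val + (N - u.val)) % N = (u.val + i.val + (N - u.val)) % N := by rw [← h', Nat.mod_add_mod]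
    rw [this, Nat.add_assoc, Nat.add_comm i.val, ← Nat.add_assoc, Nat.add_sub_cancel' u.isLt.le, Nat.add_mod_left,
      Nat.mod_eq_of_lt i.isLt]
  · rintro rfl
    apply Fin.ext
    rw [cc_self_nbr]
    simp only
    rw [Nat.add_mod, Nat.mod_mod, ← Nat.add_mod, ← Nat.add_assoc, Nat.add_comm u.val, Nat.add_assoc,
      Nat.add_sub_cancel' u.isLt.le, Nat.add_mod_right, Nat.mod_eq_of_lt v.isLt]

/-- The walk matrix of `cc N N` is `J/N`. [cite: AroraBarakCC2009, §21.1 (random-walk matrix)] -/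
theorem walkMatrix_cc_self {N : ℕ} (u v : Fin N) : (cc N N).walkMatrix u v = 1 / N := by
  rw [walkMatrix_apply, pathCount_one, card_cc_self_nbr_eq, Nat.cast_one]

/-- **`λ(K_N) = 0`**: `cc N N` has spectral bound `0` (`J/N` kills `1^⊥`). [cite: AroraBarakCC2009, §21.1 and Def. 21.2] -/
theorem spectralBound_cc_self (N : ℕ) : SpectralBound (cc N N).walkMatrix 0 := by
  refine ⟨le_rfl, fun x hx => ?_⟩
  have hAx : (cc N N).walkMatrix *ᵥ x = 0 := by
    funext u
    simp only [mulVec, dotProduct, walkMatrix_cc_self, Pi.zero_apply]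
    rw [← mul_sum, hx, mul_zero]
  rw [hAx]
  simp

end RotGraph

end Expander

end Literature.Computability.Complexity
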